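import Literature.NumberTheory.DiophantineApproximation.PolylogShiftLinearIndependence
import Literature.NumberTheory.DiophantineApproximation.PolylogShiftFourBridge
import HarnessLib

/-!
# Linear independence of `1, Li_s(1/N), Li_s(−1/N), Li_s(−1/N²)` (`s ≤ w`) over `ℚ` for `log N ≥ 64 (w+1)³`

Topic `Literature/NumberTheory/DiophantineApproximation`. The case `m = 4` of the distinct-shifts theorem
`one_lerchShift_linearIndependent` (`PolylogShiftLinearIndependence.lean`) read through the bridge
`PolylogShiftFourBridge.lean` (`Li_s(±1/N)`, `Li_s(±1/N²)` as rational combinations of `Φ_{s,r}(1/N⁴)`, `r ≤ 4`):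
for every weight `w ≥ 1` and every integer `N` with `log N ≥ 64 (w+1)³` (so that `log N⁴ ≥ 4·4³ (w+1)³`) the `3w + 1`
numbers `1, Li_s(1/N), Li_s(−1/N), Li_s(−1/N²)` (`1 ≤ s ≤ w`) are linearly independent over `ℚ`
(`one_polylog_fourPoints_linearIndependent`) — David–Hirata-Kohno–Kawashima at the three real points `1/N, −1/N, −1/N²`,
the rigidity input of the duplication TOWER of height two `{N, −N, N², −N², N⁴}` of the Kontsevich–Zagier box sectors
(`Li_s(1/N²)`, `Li_s(1/N⁴)` being dependent through the duplication formula). Crude threshold, no optimality.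
-- TODO(general form): all `2^h`-towers (`m = 2^h`) and the thresholds of arXiv:2010.09167.

References: S. David, N. Hirata-Kohno, M. Kawashima, Moscow J. Comb. Number Th. 9 (2020), Thm 2.1; and arXiv:2010.09167.
-/

noncomputable section

open Finset

namespace Literature.NumberTheory.DiophantineApproximation

open ShiftPade

/-- **Linear independence of `1, Li_s(1/N), Li_s(−1/N), Li_s(−1/N²)` (`1 ≤ s ≤ w`) over `ℚ`** for `w ≥ 1` and
`log N ≥ 64(w+1)³`: every rational relation
`a + ∑_{j<w} b_j Li_{j+1}(1/N) + ∑_{j<w} c_j Li_{j+1}(−1/N) + ∑_{j<w} d_j Li_{j+1}(−1/N²) = 0` is trivial.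
[cite: DavidHirataKohnoKawashima2020, Thm 2.1] -/
theorem one_polylog_fourPoints_linearIndependent (w : ℕ) (hw : 1 ≤ w) (N : ℕ)
    (hN : 64 * ((w : ℝ) + 1) ^ 3 ≤ Real.log N) (a : ℚ) (b c d : Fin w → ℚ)
    (h : (a : ℝ) + ∑ j : Fin w, (b j : ℝ) * DilogPade.polylogSeries ((j : ℕ) + 1) (1 / (N : ℝ)) +
      ∑ j : Fin w, (c j : ℝ) * DilogPade.polylogSeries ((j : ℕ) + 1) (-(1 / (N : ℝ))) +
      ∑ j : Fin w, (d j : ℝ) * DilogPade.polylogSeries ((j : ℕ) + 1) (-(1 / (N : ℝ) ^ 2)) = 0) :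
    a = 0 ∧ b = 0 ∧ c = 0 ∧ d = 0 := by
  -- `N ≥ 2`
  have hw1 : (1 : ℝ) ≤ w := by exact_mod_cast hw
  have hL : (512 : ℝ) ≤ Real.log N := by
    have h2 : (2 : ℝ) ^ 3 ≤ ((w : ℝ) + 1) ^ 3 := pow_le_pow_left₀ (by norm_num) (by linarith only [hw1]) 3
    norm_num at h2
    linarith only [h2, hN]
  have hN0 : (N : ℝ) ≠ 0 := by
    intro h0; rw [h0, Real.log_zero] at hL; linarith only [hL]
  have hNpos : (0 : ℝ) < N := lt_of_le_of_ne (Nat.cast_nonneg N) (Ne.symm hN0)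
  have hN2R : (2 : ℝ) ≤ N := by
    have h1 : Real.log N ≤ (N : ℝ) - 1 := Real.log_le_sub_one_of_pos hNpos
    linarith only [h1, hL]
  have hN2 : 2 ≤ N := by exact_mod_cast hN2R
  -- `M = N⁴`, `log M = 4 log N ≥ 4·4³(w+1)³`
  have hM : 4 * ((4 : ℕ) : ℝ) ^ 3 * ((w : ℝ) + 1) ^ 3 ≤ Real.log ((N ^ 4 : ℕ) : ℝ) := by
    push_cast
    rw [Real.log_pow]
    push_cast
    nlinarith [hN]
  have hcast : (1 / (N : ℝ) ^ 4) = 1 / ((N ^ 4 : ℕ) : ℝ) := by push_cast; ring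
  -- the coefficients in the `Φ`-basis
  set B : Fin w → Fin 4 → ℚ := fun j =>
    ![(N : ℚ) ^ 3 * (b j - c j), (N : ℚ) ^ 2 * (b j + c j) - 2 ^ ((j : ℕ) + 1) * (N : ℚ) ^ 2 * d j,
      (N : ℚ) * (b j - c j), (b j + c j) + 2 ^ ((j : ℕ) + 1) * d j] with hB
  have h' : (a : ℝ) + ∑ j : Fin w, ∑ r : Fin 4, (B j r : ℝ) *
      lerchShift 4 ((r : ℕ) + 1) ((j : ℕ) + 1) (1 / ((N ^ 4 : ℕ) : ℝ)) = 0 := by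
    rw [← h, ← hcast]
    have e : ∀ j : Fin w,
        (b j : ℝ) * DilogPade.polylogSeries ((j : ℕ) + 1) (1 / (N : ℝ)) +
          (c j : ℝ) * DilogPade.polylogSeries ((j : ℕ) + 1) (-(1 / (N : ℝ))) +
          (d j : ℝ) * DilogPade.polylogSeries ((j : ℕ) + 1) (-(1 / (N : ℝ) ^ 2)) =
        ∑ r : Fin 4, (B j r : ℝ) * lerchShift 4 ((r : ℕ) + 1) ((j : ℕ) + 1) (1 / (N : ℝ) ^ 4) := by
      intro j
      rw [polylogSeries_eq_lerchShift_four _ hN2, polylogSeries_neg_eq_lerchShift_four _ hN2,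
        polylogSeries_negSq_eq_lerchShift_four _ hN2, Fin.sum_univ_four]
      simp only [hB, Finset.sum_range_succ, Finset.sum_range_zero, Matrix.cons_val_zero, Matrix.cons_val_one,
        Matrix.cons_val, Fin.val_zero, Fin.val_one]
      push_cast
      norm_num
      ring
    rw [add_assoc, add_assoc, ← Finset.sum_add_distrib, ← Finset.sum_add_distrib]
    congr 1
    exact Finset.sum_congr rfl fun j _ => by rw [← e j]; ring
  obtain ⟨ha, hBz⟩ := one_lerchShift_linearIndependent 4 w (by norm_num) hw (N ^ 4) hM a B h'
  have hNQ : (N : ℚ) ≠ 0 := by exact_mod_cast (show N ≠ 0 by omega)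
  have hrows : ∀ j, b j = 0 ∧ c j = 0 ∧ d j = 0 := by
    intro j
    have h0 := congrFun (congrFun hBz j) 0
    have h1 := congrFun (congrFun hBz j) 1
    have h2 := congrFun (congrFun hBz j) 2
    have h3 := congrFun (congrFun hBz j) 3
    simp only [hB, Matrix.cons_val_zero, Matrix.cons_val_one, Matrix.cons_val, Pi.zero_apply] at h0 h1 h2 h3
    have h2' : b j - c j = 0 := by
      rcases mul_eq_zero.1 h2 with h | h
      · exact absurd h hNQ
      · exact h
    have hp : (0 : ℚ) < 2 ^ ((j : ℕ) + 1) := by positivity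
    have hN2Q : (0 : ℚ) < (N : ℚ) ^ 2 := by positivity
    have h1' : (b j + c j) - 2 ^ ((j : ℕ) + 1) * d j = 0 := by
      have : (N : ℚ) ^ 2 * ((b j + c j) - 2 ^ ((j : ℕ) + 1) * d j) = 0 := by linear_combination h1
      rcases mul_eq_zero.1 this with h | h
      · exact absurd h hN2Q.ne'
      · exact h
    have hd : d j = 0 := by
      have : 2 * (2 ^ ((j : ℕ) + 1) * d j) = 0 := by linear_combination h3 - h1'
      have : 2 ^ ((j : ℕ) + 1) * d j = 0 := by linarith
      rcases mul_eq_zero.1 this with h | h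
      · exact absurd h hp.ne'
      · exact h
    refine ⟨?_, ?_, hd⟩
    · rw [hd] at h3; linarith
    · rw [hd] at h3; linarith
  refine ⟨ha, ?_, ?_, ?_⟩
  · funext j; simp [(hrows j).1]
  · funext j; simp [(hrows j).2.1]
  · funext j; simp [(hrows j).2.2]

end Literature.NumberTheory.DiophantineApproximation
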